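import Summits.QuantumFields.BalabanUV.Beta.D1BFx.GhostStencilReflection
import Literature.MathematicalPhysics.QuantumFieldTheory.Balaban1983to89.Beta.KernelWard

/-!
# `BalabanUV.Beta.D1BFx.GhostStencilWard` — road «BF-x» for binder row D1, sub-leaf A4-leg-PARITY-gh (part 4): THE WARD-SIDE CHECK OF
# T6 v1's GHOST CONTACT — the second-order Ward law (W2) of `FineHessianWard` FORCES THE HEAD-CONTACT WEIGHT TO VANISH (any generator),
# while the reversal-symmetric contact `cK • ghX` SATISFIES (W2) with the diagonal site generator (contact weight = current weight)

HONEST DEPENDENCY (page 1, mandatory): continuum YM on T⁴ ⇐ BetaPertH ∧ nine spine estimates (0/9 proved); BetaPertH ⇐ (D1) ∧ (D4) ∧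
CAP+tail; G-an2-4 gates asym, D1 and NE2/3/4.  HONEST FRAMING (cell contract, verbatim): «discharging `BetaPertH` makes Bałaban's UV
stability UNCONDITIONAL — a real constructive-QFT result; it is NOT the continuum limit and NOT the Clay problem.»  THIS FILE DISCHARGES
NOTHING of D1 / BetaPertH: [folklore] finite bookkeeping about the road's OWN typed objects (T6 `ghCur/ghCnt/Sgh`, leaf-04/gen-2's
`ghTab`/`diagExt`, part 2's `ghX`, an2's `KernelWard.divW`) and ONE new object (`genX`, the diagonal site indicator — a definition asserting
nothing); 0 binders of the hR root are touched; no `def … : Prop`, no citation, no printed statement as hypothesis.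
ABSOLUTE RULE (cell charter, verbatim): «No internally-minted statement may enter as a cited fact. Every hypothesis is either
kernel-proved in this package or a verbatim quotation of a PUBLISHED theorem with page reference. The manuscript(s) under audit are NOT
citable for their own disputed steps — they are the thing under adjudication; programme-internal (2001/route/tribunal) claims are never
citable.»

WHY.  Gen 2's socket-only END `FineHessianWard.bondSecondMoment_Pgh_eq_avgM2_of_laws` (node R5 for leaf-04's ghost kernel `Pgh`) takes,
besides the parity sockets treated in parts 1–3, the jet-level gauge-covariance laws of an2's `KernelWard.ward_hess`: (W1) for the leg and
the first-order stencil, and (W2) `divW (diagExt (ghTab cW)) u λ′ u′ = X u ∘ Sgh λ′ u′ − Sgh λ′ u′ ∘ X u` for SOME generator family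
`X : Site 4 → MKer 4 Unit`.  Parts 2–3 showed the PARITY sockets are unfillable for T6 v1's head contact; this part shows the WARD socket
(W2) is unfillable for it too (at `cQ = 0`), and that part 2's reversal-symmetric contact passes — with its weight tied to the current's.
* §1 [folklore] ENTRY FORMULAS: `comp X (ghCur λ′ u′)` and `comp (ghCur λ′ u′) X` for an ARBITRARY kernel `X` (the current is supported on
  two entries, so the middle series is a two-term sum); `divW (diagExt T) u λ′ u′ = [u = u′ + e_{λ′}]·T λ′ u′ − [u = u′]·T λ′ u′`.
* §2 [folklore] **NO-GO `cW_eq_zero_of_W2`**: if (W2) holds for T6 v1's data at `cQ = 0` — `Sgh n cK 0` and the head-contact table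
  `ghTab cW` — with ANY generator family `X`, then `cW = 0`.  Proof: at `u = u′ + e_{λ′}` the diagonal entries `(h,h)` and `(t,t)`
  (`h = u′ + e_{λ′}`, `t = u′`) of the commutator `X u ∘ ghCur − ghCur ∘ X u` are `−(X_{th} + X_{ht})` and `+(X_{th} + X_{ht})`, summing to
  `0`, while those of the left side are `cW` and `0`.
* §3 [our object] `genX y x z := [x = y ∧ z = y]` (the colour-stripped diagonal site generator; `BiLoc (genX y) y y 1 δ` for every `δ`) and
  [folklore] **`ward₂_ghX`**: `divW (diagExt (fun λ′ u′ ↦ cK • ghX λ′ u′)) u λ′ u′ = genX u ∘ Sgh n cK 0 λ′ u′ − Sgh n cK 0 λ′ u′ ∘ genX u`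
  for ALL `u λ′ u′` — (W2) HOLDS for the pair (current `cK • ghCur`, contact `cK • ghX`): the contact weight EQUALS the current weight.
READING (prose, for the owner's CHECK-N0; nothing asserted): in the colour-stripped abelian model `U_b = exp B_b` the kernel of `D_U*D_U`
has off-diagonal entries `−e^{±B_b}` and a `B`-independent diagonal, so its same-bond second jet is the cross contact (`ghX`-shape) with the
current's weight, and gauge covariance `Δ_{B+dλ} = e^{λ}Δ_B e^{−λ}` is exact — (W2) ✓, parity ✓ (part 2); the linear transporter `1 + B_b`
produces the head contact (`ghCnt`-shape) and is covariant only to first order — (W2) ✗ (this file), parity ✗ (part 2).  Which one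
`shotCoeff`'s ghost sector carries is the owner's identification.  NOT HERE: (W1) for `Ggh`/`Sgh` (resolvent identity on `ℤ⁴`, an2's
`WardIdentity` machinery), the `Q′(U)` second jets (omitted in T6 v1 — (W2) at `cQ ≠ 0` needs them), anything printed.
Unit `b2b-balaban-beta-d1-formalise-leaf-01` (gen 3).
-/

noncomputable section

namespace Summit.QuantumFields.BalabanUV.Beta.D1BFx.GhostStencilWard

open Finset
open scoped BigOperators
open Literature.MathematicalPhysics.QuantumFieldTheory.Balaban1983to89
open Literature.MathematicalPhysics.QuantumFieldTheory.Balaban1983to89.Beta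
open B12Sec2to5 (l1 l1_nonneg)
open ExpKernelCalculus (Site MKer BiLoc comp)
open AffineAveraging (unitVec unitVec_apply)
open KernelWard (divW)
open Summit.QuantumFields.BalabanUV.Beta.D1BFx.GhostStencil (ghCur ghCur_apply ghCnt ghCnt_apply Sgh Sgh_apply unitVec_ne_zero
  l1_zero)
open Summit.QuantumFields.BalabanUV.Beta.D1BFx.ReducedKernelSandwichBlock (diagExt diagExt_apply)
open Summit.QuantumFields.BalabanUV.Beta.D1BFx.GhostKernelSandwich (ghTab ghTab_apply)
open Summit.QuantumFields.BalabanUV.Beta.D1BFx.GhostStencilReflection (ghX ghX_apply add_unitVec_ne_self self_ne_add_unitVec)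

/-! ## §1 Entry formulas: composition with the current; the pure-gauge slice of a bond-diagonal table -/

/-- [folklore] The bond-elimination unit vector (used by `KernelWard.divW`) is the affine-averaging one (used by T6). -/
theorem unitVec_eq (μ : Fin 4) : (B6BondElimination.unitVec μ : Site 4) = unitVec μ := by
  funext i
  rw [B6BondElimination.unitVec_apply, unitVec_apply]

/-- [folklore] Composition of `Unit`-fibred kernels: the fibre sum is one term. -/
theorem comp_unit_apply (A K : MKer 4 Unit) (x z : Site 4) (a b : Unit) :
    comp A K x z a b = ∑' y : Site 4, A x y () () * K y z () () := by
  obtain rfl : a = () := Subsingleton.elim _ _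
  obtain rfl : b = () := Subsingleton.elim _ _
  show (∑' y : Site 4, ∑ f : Unit, A x y () f * K y z f ()) = _
  simp only [Fintype.sum_unique, PUnit.default_eq_unit]

variable (κ' : Fin 4) (u' : Site 4)

/-- [folklore] **`X ∘ ghCur`**: `(X ∘ ghCur λ′ u′) x z = X x (u′+e) · [z = u′] − X x u′ · [z = u′+e]` for ANY kernel `X`. -/
theorem comp_ghCur_apply (X : MKer 4 Unit) (x z : Site 4) (a b : Unit) :
    comp X (ghCur κ' u') x z a b
      = X x (u' + unitVec κ') () () * (if z = u' then 1 else 0) - X x u' () () * (if z = u' + unitVec κ' then 1 else 0) := by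
  have hne : u' + unitVec κ' ≠ u' := add_unitVec_ne_self u' κ'
  rw [comp_unit_apply,
    tsum_eq_sum (s := ({u' + unitVec κ', u'} : Finset (Site 4))) (fun y hy => by
      rw [Finset.mem_insert, Finset.mem_singleton, not_or] at hy
      rw [ghCur_apply, if_neg (fun h => hy.1 h.1), if_neg (fun h => hy.2 h.1), sub_zero, mul_zero]),
    Finset.sum_pair hne, ghCur_apply, ghCur_apply]
  simp only [true_and, hne, hne.symm, false_and, if_false, sub_zero, zero_sub, mul_neg]
  ring

/-- [folklore] **`ghCur ∘ X`**: `(ghCur λ′ u′ ∘ X) x z = [x = u′+e] · X u′ z − [x = u′] · X (u′+e) z` for ANY kernel `X`. -/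
theorem ghCur_comp_apply (X : MKer 4 Unit) (x z : Site 4) (a b : Unit) :
    comp (ghCur κ' u') X x z a b
      = (if x = u' + unitVec κ' then 1 else 0) * X u' z () () - (if x = u' then 1 else 0) * X (u' + unitVec κ') z () () := by
  have hne : u' + unitVec κ' ≠ u' := add_unitVec_ne_self u' κ'
  rw [comp_unit_apply,
    tsum_eq_sum (s := ({u' + unitVec κ', u'} : Finset (Site 4))) (fun y hy => by
      rw [Finset.mem_insert, Finset.mem_singleton, not_or] at hy
      rw [ghCur_apply, if_neg (fun h => hy.2 h.2), if_neg (fun h => hy.1 h.2), sub_zero, zero_mul]),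
    Finset.sum_pair hne, ghCur_apply, ghCur_apply]
  simp only [and_true, hne, hne.symm, and_false, if_false, sub_zero, zero_sub, neg_mul]
  ring

/-- [folklore] **THE PURE-GAUGE SLICE OF A BOND-DIAGONAL TABLE**: `divW (diagExt T) u λ′ u′ = [u = u′ + e_{λ′}]·T λ′ u′ − [u = u′]·T λ′ u′`. -/
theorem divW_diagExt (T : Fin 4 → Site 4 → MKer 4 Unit) (u : Site 4) :
    divW (diagExt T) u κ' u' = (if u = u' + unitVec κ' then T κ' u' else 0) - (if u = u' then T κ' u' else 0) := by
  unfold divW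
  rw [Finset.sum_eq_single κ' (fun μ _ hμ => by
      unfold diagExt
      rw [if_neg (fun h => hμ h.1), if_neg (fun h => hμ h.1), sub_zero]) (fun h => absurd (Finset.mem_univ _) h)]
  unfold diagExt
  simp only [true_and, unitVec_eq]
  have hne : u' + unitVec κ' ≠ u' := add_unitVec_ne_self u' κ'
  by_cases h1 : u = u' + unitVec κ'
  · subst h1
    rw [add_sub_cancel_right, if_pos rfl, if_pos rfl, if_neg hne, if_neg hne]
  · have h1' : ¬(u - unitVec κ' = u') := fun h => h1 (by rw [← h, sub_add_cancel])
    rw [if_neg h1', if_neg h1]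
    by_cases h2 : u = u'
    · subst h2; rfl
    · rw [if_neg h2, if_neg h2]

/-! ## §2 The no-go: (W2) forces the head-contact weight to vanish -/

variable (n : ℕ)

/-- [folklore] At `cQ = 0` the T6 stencil is the weighted current. -/
theorem Sgh_zero_eq (cK : ℝ) (v : Site 4) : Sgh n cK 0 κ' v = cK • ghCur κ' v := by
  funext x z a b
  rw [Sgh_apply, Pi.smul_apply, Pi.smul_apply, Pi.smul_apply, Pi.smul_apply, smul_eq_mul, zero_mul, add_zero]

/-- [folklore] `comp` is homogeneous in the right factor. -/
theorem comp_smul_right' (X : MKer 4 Unit) (c : ℝ) (K : MKer 4 Unit) : comp X (c • K) = c • comp X K :=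
  KernelReflection.comp_smul_right c X K

/-- [folklore] `comp` is homogeneous in the left factor. -/
theorem comp_smul_left' (c : ℝ) (K X : MKer 4 Unit) : comp (c • K) X = c • comp K X :=
  KernelReflection.comp_smul_left c K X

include κ' u' in
/-- [folklore] **NO-GO ON THE WARD SIDE.**  If T6 v1's data at `cQ = 0` — the current `Sgh n cK 0 = cK • ghCur` and the HEAD-contact table
`ghTab cW = cW • ghCnt` — satisfy the second-order Ward law (W2) of `FineHessianWard.bondSecondMoment_Pgh_eq_avgM2_of_laws` for SOME
generator family `X`, then `cW = 0`: the head contact carries no weight.  (Entries `(h,h) + (t,t)` of (W2) at the bond `⟨u′, u′ + e_{κ′}⟩`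
and `u = u′ + e_{κ′}`.) -/
theorem cW_eq_zero_of_W2 (cK cW : ℝ) (X : Site 4 → MKer 4 Unit)
    (hW2 : ∀ (u : Site 4) (l' : Fin 4) (v : Site 4),
      divW (diagExt (ghTab cW)) u l' v = comp (X u) (Sgh n cK 0 l' v) - comp (Sgh n cK 0 l' v) (X u)) : cW = 0 := by
  have hne : u' + unitVec κ' ≠ u' := add_unitVec_ne_self u' κ'
  have key := hW2 (u' + unitVec κ') κ' u'
  rw [divW_diagExt, if_pos rfl, if_neg hne, sub_zero, Sgh_zero_eq, comp_smul_right', comp_smul_left', ghTab_apply] at key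
  have ev : ∀ x z : Site 4, cW * ghCnt κ' u' x z () ()
      = cK * comp (X (u' + unitVec κ')) (ghCur κ' u') x z () () - cK * comp (ghCur κ' u') (X (u' + unitVec κ')) x z () () := by
    intro x z
    have h := congr_fun (congr_fun (congr_fun (congr_fun key x) z) ()) ()
    simpa only [Pi.smul_apply, Pi.sub_apply, smul_eq_mul] using h
  -- entries (h,h) and (t,t)
  have e1 := ev (u' + unitVec κ') (u' + unitVec κ')
  have e2 := ev u' u'
  rw [ghCnt_apply, comp_ghCur_apply, ghCur_comp_apply] at e1 e2
  simp only [hne, hne.symm, and_self, if_true, if_false, mul_one, mul_zero, one_mul, zero_mul, sub_zero, zero_sub] at e1 e2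
  -- add them
  linarith [e1, e2]

/-! ## §3 The diagonal site generator; (W2) holds for the reversal-symmetric contact with the current's weight -/

/-- [our object] **THE COLOUR-STRIPPED DIAGONAL SITE GENERATOR** `genX y x z := [x = y ∧ z = y]` (the coefficient of `ad(t_c)` in the
generator of a gauge transformation at the fine site `y`, acting on scalar fields).  A definition; asserts nothing. -/
def genX (y : Site 4) : MKer 4 Unit := fun x z _ _ => if x = y ∧ z = y then (1 : ℝ) else 0

/-- [our object] Unfolding `genX`. -/
theorem genX_apply (y x z : Site 4) (a b : Unit) : genX y x z a b = if x = y ∧ z = y then (1 : ℝ) else 0 := rfl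

/-- [folklore] LOCALISATION SOCKET (the END's `hX` shape): `BiLoc (genX y) y y 1 δ` for every real `δ`. -/
theorem biLoc_genX (y : Site 4) (δ : ℝ) : BiLoc (genX y) y y 1 δ := by
  intro x z a b
  rw [genX_apply]
  by_cases hxz : x = y ∧ z = y
  · rw [if_pos hxz, hxz.1, hxz.2, sub_self, l1_zero, add_zero, mul_zero, Real.exp_zero, abs_one, mul_one]
  · rw [if_neg hxz, abs_zero, one_mul]; positivity

/-- [folklore] Left composition with the diagonal generator picks the row: `(genX y ∘ K) x z = [x = y]·K y z`. -/
theorem comp_genX_left (y : Site 4) (K : MKer 4 Unit) (x z : Site 4) (a b : Unit) :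
    comp (genX y) K x z a b = (if x = y then 1 else 0) * K y z () () := by
  rw [comp_unit_apply]
  have h : ∀ w : Site 4, genX y x w () () * K w z () () = if w = y then (if x = y then 1 else 0) * K y z () () else 0 := by
    intro w
    rw [genX_apply]
    by_cases hw : w = y
    · subst hw
      by_cases hx : x = w
      · rw [if_pos ⟨hx, rfl⟩, if_pos rfl, if_pos hx]
      · rw [if_neg (fun h => hx h.1), if_pos rfl, if_neg hx]
    · rw [if_neg (fun h => hw h.2), if_neg hw, zero_mul]
  rw [tsum_congr h, tsum_ite_eq]

/-- [folklore] Right composition with the diagonal generator picks the column: `(K ∘ genX y) x z = K x y·[z = y]`. -/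
theorem comp_genX_right (y : Site 4) (K : MKer 4 Unit) (x z : Site 4) (a b : Unit) :
    comp K (genX y) x z a b = K x y () () * (if z = y then 1 else 0) := by
  rw [comp_unit_apply]
  have h : ∀ w : Site 4, K x w () () * genX y w z () () = if w = y then K x y () () * (if z = y then 1 else 0) else 0 := by
    intro w
    rw [genX_apply]
    by_cases hw : w = y
    · subst hw
      by_cases hz : z = w
      · rw [if_pos ⟨rfl, hz⟩, if_pos rfl, if_pos hz]
      · rw [if_neg (fun h => hz h.2), if_pos rfl, if_neg hz]
    · rw [if_neg (fun h => hw h.1), if_neg hw, mul_zero]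
  rw [tsum_congr h, tsum_ite_eq]

/-- [folklore] **THE GENERATOR'S COMMUTATOR WITH THE CURRENT IS THE SYMMETRIC CONTACT**:
`genX u ∘ ghCur λ′ u′ − ghCur λ′ u′ ∘ genX u = ([u = u′+e] − [u = u′]) • ghX λ′ u′`. -/
theorem comm_genX_ghCur (u : Site 4) :
    comp (genX u) (ghCur κ' u') - comp (ghCur κ' u') (genX u)
      = ((if u = u' + unitVec κ' then (1 : ℝ) else 0) - (if u = u' then 1 else 0)) • ghX κ' u' := by
  have hne : u' + unitVec κ' ≠ u' := add_unitVec_ne_self u' κ'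
  funext x z a b
  rw [Pi.sub_apply, Pi.sub_apply, Pi.sub_apply, Pi.sub_apply, comp_genX_left, comp_genX_right, Pi.smul_apply, Pi.smul_apply,
    Pi.smul_apply, Pi.smul_apply, smul_eq_mul, ghCur_apply, ghCur_apply, ghX_apply]
  by_cases hu1 : u = u' + unitVec κ'
  · subst hu1
    by_cases hx1 : x = u' + unitVec κ' <;> by_cases hx2 : x = u' <;> by_cases hz1 : z = u' + unitVec κ' <;>
      by_cases hz2 : z = u' <;> simp [hx1, hx2, hz1, hz2, hne, hne.symm]
  · by_cases hu2 : u = u'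
    · subst hu2
      by_cases hx1 : x = u + unitVec κ' <;> by_cases hx2 : x = u <;> by_cases hz1 : z = u + unitVec κ' <;>
        by_cases hz2 : z = u <;> simp [hx1, hx2, hz1, hz2, hu1, hne]
    · simp [hu1, hu2]

/-- [folklore] **(W2) HOLDS FOR THE REVERSAL-SYMMETRIC CONTACT WITH THE CURRENT'S WEIGHT**: for T6's current at `cQ = 0` and the
one-bond table `fun λ′ u′ ↦ cK • ghX λ′ u′`, the second-order Ward law of `FineHessianWard` holds with the diagonal site generator, for
ALL `u λ′ u′`. -/
theorem ward₂_ghX (cK : ℝ) (u : Site 4) :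
    divW (diagExt (fun μ v => cK • ghX μ v)) u κ' u' = comp (genX u) (Sgh n cK 0 κ' u') - comp (Sgh n cK 0 κ' u') (genX u) := by
  rw [divW_diagExt, Sgh_zero_eq, comp_smul_right', comp_smul_left', ← smul_sub, comm_genX_ghCur, smul_smul]
  by_cases h1 : u = u' + unitVec κ'
  · have h2 : u ≠ u' := by rw [h1]; exact add_unitVec_ne_self u' κ'
    rw [if_pos h1, if_pos h1, if_neg h2, if_neg h2, sub_zero, sub_zero, mul_one]
  · rw [if_neg h1, if_neg h1, zero_sub]
    by_cases h2 : u = u'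
    · rw [if_pos h2, if_pos h2, zero_sub, mul_neg_one, neg_smul]
    · rw [if_neg h2, if_neg h2, sub_zero, mul_zero, zero_smul, neg_zero]

end Summit.QuantumFields.BalabanUV.Beta.D1BFx.GhostStencilWard

end
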